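import Summits.Parity.GeneralizedHardyLittlewood.Theorems.GreenTaoLevelTwoMNTwoSoftThreshold
import Literature.NumberTheory.LFunctions.PlateauMollifier

/-!
# Route `GreenTaoLevelTwo`, crux `MNTwo` (stmt-Parity-21276), line `birth`, stub `stub_mnVertical`:
# GT 2008b §8 — the reduction of "μ ⟂ local quadratics" to "μ ⟂ extendible local quadratics", one piece

Block V3 of the `stub_mnVertical` census (B. Green, T. Tao, *Quadratic uniformity of the Möbius
function*, Ann. Inst. Fourier 58 (2008) = arXiv:math/0606087, §8 "Locally quadratic phase functions,
I: a technical reduction", proof that Proposition 19 ("μ is strongly orthogonal to extendible local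
quadratics") implies Theorem 4 ("μ is strongly orthogonal to local quadratics")), for a `1`-step
nilsequence realised as a torus rotation `n ↦ F(x + nα)` (`F : ℝᵏ → ℝ`, `1`-bounded, `M`-Lipschitz
for the torus sup-distance) twisted by a phase `e(−φ(n))` that is locally quadratic on
`{N < n ≤ 2N : F(x + nα) ≠ 0}`.

This file (first of two) treats ONE PIECE of the §8 decomposition; the companion
`…MNTwoSectionEightCore` assembles the pieces.  The conclusion of Proposition 19 (for this `N`,
rotation `α`, saving `log^{-A} N`, constant `C`) is the hypothesis `hP`, exactly as printed: Bohr balls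
`B_α(n₀, ρ) = {n : ‖(n−n₀)αᵢ‖_{ℝ/ℤ} + |n−n₀|/N < ρ ∀ i}`, `ρ < 10⁻⁵`, `B_α(n₀,100ρ) ⊆ (N, 2N]`,
`φ` locally quadratic on `B_α(n₀, 100ρ)` (all `2³` vertices of a `3`-cube in the ball ⇒ the
alternating sum of `φ` is an integer), `ψ ≥ 0` supported on `B_α(n₀, ρ)` and `1`-Lipschitz for
`‖·‖_α = sup_i ‖· αᵢ‖_{ℝ/ℤ} + |·|/N`.  The proof is the source's: soft-threshold `F` at level
`100ρ₀ M` (Lemma 41, `…MNTwoSoftThreshold`), cut `(N, 2N]` into `O(1/ρ₀)` triangular bumps of width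
`ρ₀ N/4` in `n` (ends estimated trivially), split `F̃ = ∑_a F̃ χ_a`, check that each piece
`ψ_{a,b}(n) = F̃χ_a(x + nα) θ_b(n)` is supported on a Bohr ball `B_α(n₀, ρ₀)` whose `100`-fold
dilate lies in `{N < n ≤ 2N : F ≠ 0}`, has `‖·‖_α`-Lipschitz constant `≤ M + K + 16/ρ₀`, and apply
`hP` to its positive and negative parts.  Def-free; here:

* `norm_moebius_mul_mul_fourierChar_le`, `card_filter_lt_le`, `card_filter_gt_le`, `ramp_facts`,
  `bump_nonneg_le_one`, `bump_support`, `abs_bump_sub_bump_le` — small tools (ramp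
  `R = max 0 ∘ min 1`, whose Lipschitz bound is the tree's
  `Literature.NumberTheory.LFunctions.PlateauMollifier.abs_clamp_sub_clamp_le`; bumps
  `R(n/ℓ−b+1) − R(n/ℓ−b)`);
* `piece_estimate` — for one piece `ψ(n) = F̃(x+nα) χ(x+nα) w(n)`:
  `‖∑_{N<n≤2N} μ(n) ψ(n) e(−φ(n))‖ ≤ 2(M + K + 16/ρ₀) · C N / log^A N`.

References: [GreenTao2008QuadraticMobius] arXiv:math/0606087 §8 (Prop. 19 ⇒ Thm. 4), App. A Lemma 41.
-/

noncomputable section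

open Finset Real ArithmeticFunction
open scoped FourierTransform ArithmeticFunction.Moebius

namespace Summit.Parity.GeneralizedHardyLittlewood.GreenTaoLevelTwoMNTwoSectionEightPiece

open Summit.Parity.GeneralizedHardyLittlewood.GreenTaoLevelTwoMNTwoSoftThreshold
open Literature.NumberTheory.LFunctions.PlateauMollifier (abs_clamp_sub_clamp_le)

/-! ### §1 Small tools -/

/-- `‖μ(n) · r · e(t)‖ ≤ |r|`. [folklore] -/
theorem norm_moebius_mul_mul_fourierChar_le (n : ℕ) (r t : ℝ) :
    ‖((μ n : ℝ) : ℂ) * (r : ℂ) * (𝐞 t : ℂ)‖ ≤ |r| := by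
  rw [norm_mul, norm_mul, Circle.norm_coe, mul_one, Complex.norm_real, Complex.norm_real,
    Real.norm_eq_abs, Real.norm_eq_abs]
  have h1 : |((μ n : ℤ) : ℝ)| ≤ 1 := by exact_mod_cast abs_moebius_le_one
  calc |((μ n : ℤ) : ℝ)| * |r| ≤ 1 * |r| := mul_le_mul_of_nonneg_right h1 (abs_nonneg r)
    _ = |r| := one_mul _

/-- Counting the left end: `#{N < n ≤ 2N : n < X} ≤ X − N` for `X ≥ N`. [folklore] -/
theorem card_filter_lt_le {N : ℕ} {X : ℝ} (hX : (N : ℝ) ≤ X) :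
    (#((Ioc N (2 * N)).filter fun n : ℕ => (n : ℝ) < X) : ℝ) ≤ X - N := by
  have hX0 : 0 ≤ X := le_trans (Nat.cast_nonneg N) hX
  have hsub : (Ioc N (2 * N)).filter (fun n : ℕ => (n : ℝ) < X) ⊆ Ioc N ⌊X⌋₊ := by
    intro n hn
    rw [mem_filter, mem_Ioc] at hn
    rw [mem_Ioc]
    exact ⟨hn.1.1, (Nat.le_floor_iff hX0).2 hn.2.le⟩
  have hNf : N ≤ ⌊X⌋₊ := (Nat.le_floor_iff hX0).2 hX
  calc (#((Ioc N (2 * N)).filter fun n : ℕ => (n : ℝ) < X) : ℝ) ≤ #(Ioc N ⌊X⌋₊) := by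
        exact_mod_cast card_le_card hsub
    _ = ((⌊X⌋₊ - N : ℕ) : ℝ) := by rw [Nat.card_Ioc]
    _ = (⌊X⌋₊ : ℝ) - N := Nat.cast_sub hNf
    _ ≤ X - N := by linarith [Nat.floor_le hX0]

/-- Counting the right end: `#{N < n ≤ 2N : Y < n} ≤ 2N − Y + 1` for `0 ≤ Y ≤ 2N`. [folklore] -/
theorem card_filter_gt_le {N : ℕ} {Y : ℝ} (hY0 : 0 ≤ Y) (hY : Y ≤ 2 * N) :
    (#((Ioc N (2 * N)).filter fun n : ℕ => Y < (n : ℝ)) : ℝ) ≤ 2 * N - Y + 1 := by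
  have hsub : (Ioc N (2 * N)).filter (fun n : ℕ => Y < (n : ℝ)) ⊆ Ioc ⌊Y⌋₊ (2 * N) := by
    intro n hn
    rw [mem_filter, mem_Ioc] at hn
    rw [mem_Ioc]
    refine ⟨?_, hn.1.2⟩
    have : (⌊Y⌋₊ : ℝ) < n := (Nat.floor_le hY0).trans_lt hn.2
    exact_mod_cast this
  have hfl : ⌊Y⌋₊ ≤ 2 * N := by
    have : (⌊Y⌋₊ : ℝ) ≤ 2 * N := (Nat.floor_le hY0).trans hY
    exact_mod_cast this
  calc (#((Ioc N (2 * N)).filter fun n : ℕ => Y < (n : ℝ)) : ℝ) ≤ #(Ioc ⌊Y⌋₊ (2 * N)) := by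
        exact_mod_cast card_le_card hsub
    _ = ((2 * N - ⌊Y⌋₊ : ℕ) : ℝ) := by rw [Nat.card_Ioc]
    _ = 2 * (N : ℝ) - ⌊Y⌋₊ := by rw [Nat.cast_sub hfl]; push_cast; ring
    _ ≤ 2 * N - Y + 1 := by linarith [Nat.lt_floor_add_one Y]

/-- The ramp `R(u) = max 0 (min 1 u)` takes values in `[0, 1]`, is monotone, vanishes for `u ≤ 0`
and equals `1` for `u ≥ 1`. [folklore] -/
theorem ramp_facts :
    (∀ u : ℝ, 0 ≤ max 0 (min 1 u) ∧ max 0 (min 1 u) ≤ 1) ∧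
    (∀ u v : ℝ, u ≤ v → max 0 (min 1 u) ≤ max 0 (min 1 v)) ∧
    (∀ u : ℝ, u ≤ 0 → max 0 (min 1 u) = 0) ∧ (∀ u : ℝ, 1 ≤ u → max 0 (min 1 u) = 1) := by
  refine ⟨fun u => ⟨le_max_left _ _, max_le zero_le_one (min_le_left _ _)⟩,
    fun u v huv => max_le_max le_rfl (min_le_min le_rfl huv),
    fun u hu => max_eq_left ((min_le_right _ _).trans hu), fun u hu => ?_⟩
  rw [min_eq_left hu, max_eq_right zero_le_one]

/-- The bump `θ_b(n) = R(n/ℓ − b + 1) − R(n/ℓ − b)` takes values in `[0, 1]`. [folklore] -/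
theorem bump_nonneg_le_one {ℓ : ℝ} (b n : ℤ) :
    0 ≤ max 0 (min 1 ((n : ℝ) / ℓ - b + 1)) - max 0 (min 1 ((n : ℝ) / ℓ - b)) ∧
      max 0 (min 1 ((n : ℝ) / ℓ - b + 1)) - max 0 (min 1 ((n : ℝ) / ℓ - b)) ≤ 1 := by
  obtain ⟨hR01, hRmono, -, -⟩ := ramp_facts
  have h1 := hRmono ((n : ℝ) / ℓ - b) ((n : ℝ) / ℓ - b + 1) (by linarith)
  have h2 := hR01 ((n : ℝ) / ℓ - b + 1)
  have h3 := hR01 ((n : ℝ) / ℓ - b)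
  exact ⟨by linarith, by linarith⟩

/-- Support of the bump: `θ_b(n) ≠ 0 ⇒ (b−1)ℓ < n < (b+1)ℓ` (`ℓ > 0`). [folklore] -/
theorem bump_support {ℓ : ℝ} (hℓ : 0 < ℓ) (b n : ℤ)
    (h : max 0 (min 1 ((n : ℝ) / ℓ - b + 1)) - max 0 (min 1 ((n : ℝ) / ℓ - b)) ≠ 0) :
    ((b : ℝ) - 1) * ℓ < n ∧ (n : ℝ) < (b + 1) * ℓ := by
  obtain ⟨-, -, hR0, hR1⟩ := ramp_facts
  by_contra hcon
  apply h
  rcases not_and_or.1 hcon with h' | h'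
  · push Not at h'
    have hu : (n : ℝ) / ℓ - b + 1 ≤ 0 := by
      have : (n : ℝ) / ℓ ≤ b - 1 := by rw [div_le_iff₀ hℓ]; linarith
      linarith
    rw [hR0 _ hu, hR0 _ (by linarith), sub_self]
  · push Not at h'
    have hu : 1 ≤ (n : ℝ) / ℓ - b := by
      rw [le_sub_iff_add_le, le_div_iff₀ hℓ]; linarith
    rw [hR1 _ hu, hR1 _ (by linarith), sub_self]

/-- The bump is `(2/ℓ)`-Lipschitz in `n`. [folklore] -/
theorem abs_bump_sub_bump_le {ℓ : ℝ} (hℓ : 0 < ℓ) (b n n' : ℤ) :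
    |max 0 (min 1 ((n : ℝ) / ℓ - b + 1)) - max 0 (min 1 ((n : ℝ) / ℓ - b)) -
        (max 0 (min 1 ((n' : ℝ) / ℓ - b + 1)) - max 0 (min 1 ((n' : ℝ) / ℓ - b)))| ≤
      2 * |((n - n' : ℤ) : ℝ)| / ℓ := by
  have h1 := abs_clamp_sub_clamp_le ((n : ℝ) / ℓ - b + 1) ((n' : ℝ) / ℓ - b + 1)
  have h2 := abs_clamp_sub_clamp_le ((n : ℝ) / ℓ - b) ((n' : ℝ) / ℓ - b)
  have he : |(n : ℝ) / ℓ - b - ((n' : ℝ) / ℓ - b)| = |((n - n' : ℤ) : ℝ)| / ℓ := by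
    rw [show (n : ℝ) / ℓ - b - ((n' : ℝ) / ℓ - b) = ((n - n' : ℤ) : ℝ) / ℓ by push_cast; ring,
      abs_div, abs_of_pos hℓ]
  have he' : |(n : ℝ) / ℓ - b + 1 - ((n' : ℝ) / ℓ - b + 1)| = |((n - n' : ℤ) : ℝ)| / ℓ := by
    rw [show (n : ℝ) / ℓ - b + 1 - ((n' : ℝ) / ℓ - b + 1) = ((n - n' : ℤ) : ℝ) / ℓ by
      push_cast; ring, abs_div, abs_of_pos hℓ]
  rw [he] at h2; rw [he'] at h1
  calc |max 0 (min 1 ((n : ℝ) / ℓ - b + 1)) - max 0 (min 1 ((n : ℝ) / ℓ - b)) -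
        (max 0 (min 1 ((n' : ℝ) / ℓ - b + 1)) - max 0 (min 1 ((n' : ℝ) / ℓ - b)))|
      = |(max 0 (min 1 ((n : ℝ) / ℓ - b + 1)) - max 0 (min 1 ((n' : ℝ) / ℓ - b + 1))) -
          (max 0 (min 1 ((n : ℝ) / ℓ - b)) - max 0 (min 1 ((n' : ℝ) / ℓ - b)))| := by ring_nf
    _ ≤ |((n - n' : ℤ) : ℝ)| / ℓ + |((n - n' : ℤ) : ℝ)| / ℓ := (abs_sub _ _).trans (add_le_add h1 h2)
    _ = 2 * |((n - n' : ℤ) : ℝ)| / ℓ := by ring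

/-! ### §2 One piece `ψ(n) = F̃χ_a(x + nα) w(n)` -/

/-- **One piece of the §8 decomposition.**  For a `1`-bounded torus-`M`-Lipschitz `F̃` whose support
forces `F ≠ 0` at torus-distance `≤ 100ρ₀` (Lemma 41 (ii)), a `1`-bounded torus-`K`-Lipschitz `χ`
with support of torus-diameter `< ρ₀/4`, and a bump `w` in `n` (values in `[0,1]`, slope
`≤ 16/(ρ₀N)`, support of diameter `< ρ₀N/4` whose `100ρ₀N`-neighbourhood lies in `(N, 2N]`), the
piece `ψ(n) = F̃(x+nα) χ(x+nα) w(n)` meets the hypotheses of Proposition 19 on a Bohr ball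
`B_α(n₀, ρ₀)` after division by `Λ = M + K + 16/ρ₀` and splitting into `ψ⁺ − ψ⁻`; hence
`‖∑_{N<n≤2N} μ(n) ψ(n) e(−φ(n))‖ ≤ 2Λ · C N / log^A N`.
[cite: GreenTao2008QuadraticMobius, §8, proof that Proposition 19 implies Theorem 4] -/
theorem piece_estimate (k : ℕ) {N : ℕ} (hN : 1 ≤ N) {M K ρ₀ C A : ℝ}
    (hM : 0 ≤ M) (hK : 0 ≤ K) (hρ₀ : 0 < ρ₀) (hρ₀' : 100000 * ρ₀ < 1) (hC : 0 ≤ C)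
    (α x : Fin k → ℝ) (F Ft χ : (Fin k → ℝ) → ℝ) (w : ℤ → ℝ) (hFt1 : ∀ y, |Ft y| ≤ 1)
    (hFtlip : ∀ (y y' : Fin k → ℝ) (t : ℝ), 0 ≤ t →
      (∀ i, ‖((y i - y' i : ℝ) : AddCircle (1 : ℝ))‖ ≤ t) → |Ft y - Ft y'| ≤ M * t)
    (hFsupp : ∀ y y' : Fin k → ℝ, Ft y ≠ 0 →
      (∀ i, ‖((y i - y' i : ℝ) : AddCircle (1 : ℝ))‖ ≤ 100 * ρ₀) → F y' ≠ 0)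
    (hχ1 : ∀ y, |χ y| ≤ 1)
    (hχlip : ∀ (y y' : Fin k → ℝ) (t : ℝ), 0 ≤ t →
      (∀ i, ‖((y i - y' i : ℝ) : AddCircle (1 : ℝ))‖ ≤ t) → |χ y - χ y'| ≤ K * t)
    (hχsupp : ∀ (y y' : Fin k → ℝ), χ y ≠ 0 → χ y' ≠ 0 →
      ∀ i, ‖((y i - y' i : ℝ) : AddCircle (1 : ℝ))‖ < ρ₀ / 4)
    (hw01 : ∀ n, 0 ≤ w n ∧ w n ≤ 1)
    (hwlip : ∀ n n' : ℤ, |w n - w n'| ≤ 16 / ρ₀ * (|((n - n' : ℤ) : ℝ)| / N))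
    (hwsupp : ∀ n n' : ℤ, w n ≠ 0 → w n' ≠ 0 → |((n - n' : ℤ) : ℝ)| < ρ₀ / 4 * N)
    (hwrange : ∀ n n' : ℤ, w n ≠ 0 → |((n' - n : ℤ) : ℝ)| < 100 * ρ₀ * N →
      (N : ℤ) < n' ∧ n' ≤ 2 * N)
    (φ : ℤ → ℝ)
    (hφ : ∀ n h₁ h₂ h₃ : ℤ,
      (∀ e₁ e₂ e₃ : ℕ, e₁ ≤ 1 → e₂ ≤ 1 → e₃ ≤ 1 →
        (N : ℤ) < n + e₁ * h₁ + e₂ * h₂ + e₃ * h₃ ∧ n + e₁ * h₁ + e₂ * h₂ + e₃ * h₃ ≤ 2 * N ∧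
          F (x + ((n + e₁ * h₁ + e₂ * h₂ + e₃ * h₃ : ℤ) : ℝ) • α) ≠ 0) →
      ∃ z : ℤ, φ (n + h₁ + h₂ + h₃) - φ (n + h₁ + h₂) - φ (n + h₁ + h₃) - φ (n + h₂ + h₃)
        + φ (n + h₁) + φ (n + h₂) + φ (n + h₃) - φ n = z)
    (hP : ∀ (n₀ : ℤ) (ρ : ℝ), 0 < ρ → 100000 * ρ < 1 →
      (∀ n : ℤ, ((∀ i, ‖((((n - n₀ : ℤ) : ℝ) * α i : ℝ) : AddCircle (1 : ℝ))‖ +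
          |((n - n₀ : ℤ) : ℝ)| / N < 100 * ρ) ∧ |((n - n₀ : ℤ) : ℝ)| / N < 100 * ρ) →
        (N : ℤ) < n ∧ n ≤ 2 * N) →
      ∀ φ : ℤ → ℝ,
        (∀ n h₁ h₂ h₃ : ℤ,
          (∀ e₁ e₂ e₃ : ℕ, e₁ ≤ 1 → e₂ ≤ 1 → e₃ ≤ 1 →
            (∀ i, ‖((((n + e₁ * h₁ + e₂ * h₂ + e₃ * h₃ - n₀ : ℤ) : ℝ) * α i : ℝ) :
                AddCircle (1 : ℝ))‖ +
              |((n + e₁ * h₁ + e₂ * h₂ + e₃ * h₃ - n₀ : ℤ) : ℝ)| / N < 100 * ρ) ∧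
            |((n + e₁ * h₁ + e₂ * h₂ + e₃ * h₃ - n₀ : ℤ) : ℝ)| / N < 100 * ρ) →
          ∃ z : ℤ, φ (n + h₁ + h₂ + h₃) - φ (n + h₁ + h₂) - φ (n + h₁ + h₃) - φ (n + h₂ + h₃)
            + φ (n + h₁) + φ (n + h₂) + φ (n + h₃) - φ n = z) →
        ∀ ψ : ℤ → ℝ, (∀ n, 0 ≤ ψ n) →
          (∀ n, ψ n ≠ 0 →
            (∀ i, ‖((((n - n₀ : ℤ) : ℝ) * α i : ℝ) : AddCircle (1 : ℝ))‖ +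
                |((n - n₀ : ℤ) : ℝ)| / N < ρ) ∧ |((n - n₀ : ℤ) : ℝ)| / N < ρ) →
          (∀ (n n' : ℤ) (t : ℝ), 0 ≤ t →
            (∀ i, ‖((((n - n' : ℤ) : ℝ) * α i : ℝ) : AddCircle (1 : ℝ))‖ ≤ t) →
              |ψ n - ψ n'| ≤ t + |((n - n' : ℤ) : ℝ)| / N) →
          ‖∑ n ∈ Ioc N (2 * N), ((μ n : ℝ) : ℂ) * ((ψ n : ℝ) : ℂ) * (𝐞 (-(φ n)) : ℂ)‖ ≤
            C * N / Real.log N ^ A) :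
    ‖∑ n ∈ Ioc N (2 * N), ((μ n : ℝ) : ℂ) *
        ((Ft (x + (n : ℝ) • α) * χ (x + (n : ℝ) • α) * w n : ℝ) : ℂ) * (𝐞 (-(φ n)) : ℂ)‖ ≤
      2 * (M + K + 16 / ρ₀) * (C * N / Real.log N ^ A) := by
  have hNr : (1 : ℝ) ≤ N := by exact_mod_cast hN
  have hNpos : (0 : ℝ) < N := by linarith
  set y : ℤ → (Fin k → ℝ) := fun n => x + (n : ℝ) • α with hy
  have hyn : ∀ n : ℕ, x + (n : ℝ) • α = y n := fun n => by simp [hy]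
  have hysub : ∀ (n n' : ℤ) (i : Fin k), y n i - y n' i = ((n - n' : ℤ) : ℝ) * α i := by
    intro n n' i; simp only [hy, Pi.add_apply, Pi.smul_apply, smul_eq_mul]; push_cast; ring
  set Lam : ℝ := M + K + 16 / ρ₀ with hLam
  have h16 : 0 < 16 / ρ₀ := by positivity
  have hLampos : 0 < Lam := by rw [hLam]; linarith
  have hlogA : 0 ≤ C * N / Real.log N ^ A :=
    div_nonneg (by positivity) (Real.rpow_nonneg (Real.log_nonneg hNr) A)
  set ψ : ℤ → ℝ := fun n => Ft (y n) * χ (y n) * w n with hψ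
  have hsum_eq : ∑ n ∈ Ioc N (2 * N), ((μ n : ℝ) : ℂ) *
      ((Ft (x + (n : ℝ) • α) * χ (x + (n : ℝ) • α) * w n : ℝ) : ℂ) * (𝐞 (-(φ n)) : ℂ) =
      ∑ n ∈ Ioc N (2 * N), ((μ n : ℝ) : ℂ) * ((ψ n : ℝ) : ℂ) * (𝐞 (-(φ n)) : ℂ) := by
    refine sum_congr rfl fun n _ => ?_
    rw [hyn n]
  rw [hsum_eq]
  by_cases hzero : ∀ n, ψ n = 0
  · have : ∑ n ∈ Ioc N (2 * N), ((μ n : ℝ) : ℂ) * ((ψ n : ℝ) : ℂ) * (𝐞 (-(φ n)) : ℂ) = 0 :=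
      sum_eq_zero fun n _ => by rw [hzero n]; simp
    rw [this, norm_zero]; positivity
  push Not at hzero
  obtain ⟨n₀, hn₀⟩ := hzero
  have hne : ∀ n, ψ n ≠ 0 → Ft (y n) ≠ 0 ∧ χ (y n) ≠ 0 ∧ w n ≠ 0 := by
    intro n hn
    simp only [hψ] at hn
    exact ⟨fun h => hn (by rw [h]; ring), fun h => hn (by rw [h]; ring),
      fun h => hn (by rw [h]; ring)⟩
  obtain ⟨hFt0, hχ0, hw0⟩ := hne n₀ hn₀
  -- (s1) support of `ψ` inside the Bohr ball `B(n₀, ρ₀)`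
  have hsupp : ∀ n, ψ n ≠ 0 →
      (∀ j, ‖((((n - n₀ : ℤ) : ℝ) * α j : ℝ) : AddCircle (1 : ℝ))‖ +
          |((n - n₀ : ℤ) : ℝ)| / N < ρ₀) ∧ |((n - n₀ : ℤ) : ℝ)| / N < ρ₀ := by
    intro n hn
    obtain ⟨hFtn, hχn, hwn⟩ := hne n hn
    have hdist : |((n - n₀ : ℤ) : ℝ)| / N < ρ₀ / 4 := by
      rw [div_lt_iff₀ hNpos]; exact hwsupp n n₀ hwn hw0
    have htor : ∀ j, ‖((((n - n₀ : ℤ) : ℝ) * α j : ℝ) : AddCircle (1 : ℝ))‖ < ρ₀ / 4 := by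
      intro j; rw [← hysub n n₀ j]; exact hχsupp (y n) (y n₀) hχn hχ0 j
    exact ⟨fun j => by linarith [htor j], by linarith⟩
  -- (s2) the dilated ball lies in `{N < n ≤ 2N : F ≠ 0}`
  have hball : ∀ n : ℤ,
      ((∀ j, ‖((((n - n₀ : ℤ) : ℝ) * α j : ℝ) : AddCircle (1 : ℝ))‖ +
          |((n - n₀ : ℤ) : ℝ)| / N < 100 * ρ₀) ∧ |((n - n₀ : ℤ) : ℝ)| / N < 100 * ρ₀) →
      (N : ℤ) < n ∧ n ≤ 2 * N ∧ F (y n) ≠ 0 := by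
    intro n hn
    have hd : |((n - n₀ : ℤ) : ℝ)| < 100 * ρ₀ * N := by
      have := hn.2; rwa [div_lt_iff₀ hNpos] at this
    obtain ⟨h1, h2⟩ := hwrange n₀ n hw0 hd
    refine ⟨h1, h2, ?_⟩
    have htor : ∀ j, ‖((y n₀ j - y n j : ℝ) : AddCircle (1 : ℝ))‖ ≤ 100 * ρ₀ := by
      intro j
      rw [hysub n₀ n j, show ((n₀ - n : ℤ) : ℝ) * α j = -(((n - n₀ : ℤ) : ℝ) * α j) by
        push_cast; ring, AddCircle.coe_neg, norm_neg]
      have := hn.1 j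
      have h0 : 0 ≤ |((n - n₀ : ℤ) : ℝ)| / N := by positivity
      linarith
    exact hFsupp (y n₀) (y n) hFt0 htor
  -- (s3) `φ` is locally quadratic on the dilated ball
  have hφ' : ∀ n h₁ h₂ h₃ : ℤ,
      (∀ e₁ e₂ e₃ : ℕ, e₁ ≤ 1 → e₂ ≤ 1 → e₃ ≤ 1 →
        (∀ j, ‖((((n + e₁ * h₁ + e₂ * h₂ + e₃ * h₃ - n₀ : ℤ) : ℝ) * α j : ℝ) :
            AddCircle (1 : ℝ))‖ +
          |((n + e₁ * h₁ + e₂ * h₂ + e₃ * h₃ - n₀ : ℤ) : ℝ)| / N < 100 * ρ₀) ∧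
        |((n + e₁ * h₁ + e₂ * h₂ + e₃ * h₃ - n₀ : ℤ) : ℝ)| / N < 100 * ρ₀) →
      ∃ z : ℤ, φ (n + h₁ + h₂ + h₃) - φ (n + h₁ + h₂) - φ (n + h₁ + h₃) - φ (n + h₂ + h₃)
        + φ (n + h₁) + φ (n + h₂) + φ (n + h₃) - φ n = z := by
    intro n h₁ h₂ h₃ hc
    refine hφ n h₁ h₂ h₃ fun e₁ e₂ e₃ he₁ he₂ he₃ => ?_
    have h := hball _ (hc e₁ e₂ e₃ he₁ he₂ he₃)
    exact ⟨h.1, h.2.1, by simpa [hy] using h.2.2⟩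
  -- (s4) Lipschitz bound for `ψ` (with `|u₁u₂ − v₁v₂| ≤ |u₁ − v₁| + |u₂ − v₂|` for `|u₂|,|v₁| ≤ 1`)
  have abs_mul_sub_mul_le : ∀ {u₁ u₂ v₁ v₂ : ℝ}, |u₂| ≤ 1 → |v₁| ≤ 1 →
      |u₁ * u₂ - v₁ * v₂| ≤ |u₁ - v₁| + |u₂ - v₂| := by
    intro u₁ u₂ v₁ v₂ hu₂ hv₁
    rw [show u₁ * u₂ - v₁ * v₂ = (u₁ - v₁) * u₂ + v₁ * (u₂ - v₂) by ring]
    calc |(u₁ - v₁) * u₂ + v₁ * (u₂ - v₂)| ≤ |(u₁ - v₁) * u₂| + |v₁ * (u₂ - v₂)| := abs_add_le _ _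
      _ = |u₁ - v₁| * |u₂| + |v₁| * |u₂ - v₂| := by rw [abs_mul, abs_mul]
      _ ≤ |u₁ - v₁| * 1 + 1 * |u₂ - v₂| :=
          add_le_add (mul_le_mul_of_nonneg_left hu₂ (abs_nonneg _))
            (mul_le_mul_of_nonneg_right hv₁ (abs_nonneg _))
      _ = |u₁ - v₁| + |u₂ - v₂| := by ring
  have hψlip : ∀ (n n' : ℤ) (t : ℝ), 0 ≤ t →
      (∀ j, ‖((((n - n' : ℤ) : ℝ) * α j : ℝ) : AddCircle (1 : ℝ))‖ ≤ t) →
      |ψ n - ψ n'| ≤ Lam * (t + |((n - n' : ℤ) : ℝ)| / N) := by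
    intro n n' t ht htor
    have htor' : ∀ j, ‖((y n j - y n' j : ℝ) : AddCircle (1 : ℝ))‖ ≤ t := by
      intro j; rw [hysub]; exact htor j
    have hG : |Ft (y n) * χ (y n) - Ft (y n') * χ (y n')| ≤ (M + K) * t := by
      calc |Ft (y n) * χ (y n) - Ft (y n') * χ (y n')|
          ≤ |Ft (y n) - Ft (y n')| + |χ (y n) - χ (y n')| :=
            abs_mul_sub_mul_le (hχ1 _) (hFt1 _)
        _ ≤ M * t + K * t := add_le_add (hFtlip _ _ t ht htor') (hχlip _ _ t ht htor')
        _ = (M + K) * t := by ring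
    have hG1 : |Ft (y n') * χ (y n')| ≤ 1 := by
      rw [abs_mul]
      calc |Ft (y n')| * |χ (y n')| ≤ 1 * 1 :=
            mul_le_mul (hFt1 _) (hχ1 _) (abs_nonneg _) zero_le_one
        _ = 1 := one_mul _
    have hw1 : |w n| ≤ 1 := by rw [abs_of_nonneg (hw01 n).1]; exact (hw01 n).2
    have hdist0 : 0 ≤ |((n - n' : ℤ) : ℝ)| / N := by positivity
    calc |ψ n - ψ n'| = |Ft (y n) * χ (y n) * w n - Ft (y n') * χ (y n') * w n'| := by
          simp only [hψ]
      _ ≤ |Ft (y n) * χ (y n) - Ft (y n') * χ (y n')| + |w n - w n'| :=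
          abs_mul_sub_mul_le hw1 hG1
      _ ≤ (M + K) * t + 16 / ρ₀ * (|((n - n' : ℤ) : ℝ)| / N) := add_le_add hG (hwlip n n')
      _ ≤ Lam * t + Lam * (|((n - n' : ℤ) : ℝ)| / N) := by
          apply add_le_add
          · exact mul_le_mul_of_nonneg_right (by rw [hLam]; linarith) ht
          · exact mul_le_mul_of_nonneg_right (by rw [hLam]; linarith) hdist0
      _ = Lam * (t + |((n - n' : ℤ) : ℝ)| / N) := by ring
  -- (s5) apply Proposition 19 to the positive and negative parts of `ψ / Λ`
  have hpart : ∀ s : ℝ, |s| = 1 →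
      ‖∑ n ∈ Ioc N (2 * N), ((μ n : ℝ) : ℂ) *
          (((fun m : ℤ => max (s * ψ m) 0 / Lam) n : ℝ) : ℂ) * (𝐞 (-(φ n)) : ℂ)‖ ≤
        C * N / Real.log N ^ A := by
    intro s hs1
    refine hP n₀ ρ₀ hρ₀ hρ₀' (fun n hn => ⟨(hball n hn).1, (hball n hn).2.1⟩) φ hφ'
      (fun m => max (s * ψ m) 0 / Lam) (fun m => by positivity) (fun m hm => ?_) ?_
    · apply hsupp m
      intro h0
      apply hm
      simp [h0]
    · intro n n' t ht htor
      have h1 : |max (s * ψ n) 0 / Lam - max (s * ψ n') 0 / Lam| ≤ |ψ n - ψ n'| / Lam := by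
        rw [← sub_div, abs_div, abs_of_pos hLampos]
        apply div_le_div_of_nonneg_right _ hLampos.le
        calc |max (s * ψ n) 0 - max (s * ψ n') 0| ≤ |s * ψ n - s * ψ n'| :=
              abs_max_sub_max_le_abs _ _ _
          _ = |ψ n - ψ n'| := by rw [← mul_sub, abs_mul, hs1, one_mul]
      calc |max (s * ψ n) 0 / Lam - max (s * ψ n') 0 / Lam| ≤ |ψ n - ψ n'| / Lam := h1
        _ ≤ Lam * (t + |((n - n' : ℤ) : ℝ)| / N) / Lam :=
            div_le_div_of_nonneg_right (hψlip n n' t ht htor) hLampos.le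
        _ = t + |((n - n' : ℤ) : ℝ)| / N := by field_simp
  have hplus := hpart 1 (by simp)
  have hminus := hpart (-1) (by simp)
  -- recombine: `ψ = Λ (ψ⁺ - ψ⁻)`
  have hdecomp : ∑ n ∈ Ioc N (2 * N), ((μ n : ℝ) : ℂ) * ((ψ n : ℝ) : ℂ) * (𝐞 (-(φ n)) : ℂ) =
      (Lam : ℂ) * (∑ n ∈ Ioc N (2 * N), ((μ n : ℝ) : ℂ) *
          (((fun m : ℤ => max (1 * ψ m) 0 / Lam) n : ℝ) : ℂ) * (𝐞 (-(φ n)) : ℂ) -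
        ∑ n ∈ Ioc N (2 * N), ((μ n : ℝ) : ℂ) *
          (((fun m : ℤ => max (-1 * ψ m) 0 / Lam) n : ℝ) : ℂ) * (𝐞 (-(φ n)) : ℂ)) := by
    rw [← sum_sub_distrib, mul_sum]
    refine sum_congr rfl fun n _ => ?_
    have hre : (ψ n : ℝ) = Lam * (max (1 * ψ n) 0 / Lam - max (-1 * ψ n) 0 / Lam) := by
      rw [← sub_div, mul_div_cancel₀ _ hLampos.ne', one_mul, neg_one_mul,
        max_zero_sub_max_neg_zero_eq_self]
    rw [hre]; push_cast; ring
  rw [hdecomp, norm_mul, Complex.norm_real, Real.norm_eq_abs, abs_of_pos hLampos]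
  calc Lam * _ ≤ Lam * (C * N / Real.log N ^ A + C * N / Real.log N ^ A) := by
        apply mul_le_mul_of_nonneg_left _ hLampos.le
        exact (norm_sub_le _ _).trans (add_le_add hplus hminus)
    _ = 2 * (M + K + 16 / ρ₀) * (C * N / Real.log N ^ A) := by rw [hLam]; ring

end Summit.Parity.GeneralizedHardyLittlewood.GreenTaoLevelTwoMNTwoSectionEightPiece
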